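import Literature.NumberTheory.EllipticCurves.PoonenRainsCocycle
import Literature.NumberTheory.GaloisRepresentations.ContinuousCupProduct
import Mathlib.Tactic.LinearCombination
import HarnessLib

/-!
# The polar form of the Poonen–Rains quadratic map at level `2`: the Weil-pairing cup product

For the explicit Poonen–Rains map `q_L = prClass W h2 L : H¹(Γ_L, E[2]) → H²(Γ_L, μ₂)`
(`PoonenRainsCocycle`) this file proves that it is a QUADRATIC map whose polar form is the cup product
for the commutator pairing of the Heisenberg group, i.e. the Weil pairing `e₂ : E[2] × E[2] → μ₂`
(`ThetaDatumWeierstrass.coe_toMul_commForm_heisenbergGm`: `e₂(P, Q) = −1` for `P ≠ Q` nonzero):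

* `HeisenbergDatum.commForm_add_left/right`, `α_commForm` — the commutator pairing of ANY Heisenberg
  datum is bi-additive and equivariant (Brown IV §3);
* `weilPairingTwo W h2 L : ContPairing E[2]|_{Γ_L} E[2]|_{Γ_L} μ₂|_{Γ_L}` — the commutator pairing as a
  continuous equivariant `ℤ`-bilinear pairing of the tree's topological representations;
* `prCocycle_add` — `prCocycle (ξ+η) = prCocycle ξ + prCocycle η + (η ∪ ξ) − ∂(σ ↦ m(ξ_σ, η_σ))`
  on the nose (`HeisenbergDatum.conn_add`);
* **`prClass_add`** — `q_L(a + b) = q_L(a) + q_L(b) + (b ∪_{e₂} a)` in `H²(Γ_L, μ₂)`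
  (Poonen–Rains 2012 Cor. 4.6 / Prop. 4.7: `q` is a quadratic form whose associated bilinear form is
  the cup product of the Weil pairing; Zarhin 1974).

References: [PoonenRains2012] §4.1, Cor. 4.6, Prop. 4.7; [SerreGaloisCohomology1997] I §5.7;
K. S. Brown, *Cohomology of Groups* IV §3 [Brown1982].  No named fact is introduced.
-/

set_option autoImplicit false

namespace Literature.Algebra.Homology

namespace HeisenbergDatum

universe u v w

variable {G : Type u} {M : Type v} {A : Type w} [Monoid G] [AddCommGroup M] [AddCommGroup A]
variable (D : HeisenbergDatum G M A)

/-- The commutator pairing is additive in the second variable (centrality of the extension; from the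
`2`-cocycle identity of `m`). [cite: Brown1982, Ch. IV §3 (extensions defined by a 2-cocycle)] -/
theorem commForm_add_right (x y z : M) : D.commForm x (y + z) = D.commForm x y + D.commForm x z := by
  simp only [commForm_apply]
  have h1 := D.m_cocycle x y z
  have h2 := D.m_cocycle y z x
  have h3 := D.m_cocycle y x z
  rw [add_comm z x] at h2
  rw [add_comm y x] at h3
  linear_combination (norm := abel) -h1 - h2 + h3

/-- The commutator pairing is additive in the first variable. [cite: Brown1982, Ch. IV §3 (extensions defined by a 2-cocycle)] -/
theorem commForm_add_left (x y z : M) : D.commForm (x + y) z = D.commForm x z + D.commForm y z := by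
  rw [commForm_swap, commForm_add_right, D.commForm_swap z x, D.commForm_swap z y, neg_add, neg_neg, neg_neg]

/-- The commutator pairing in the first variable, as an additive homomorphism. [cite: Brown1982, Ch. IV §3 (extensions defined by a 2-cocycle)] -/
def commFormLeftHom (z : M) : M →+ A where
  toFun x := D.commForm x z
  map_zero' := D.commForm_zero_left z
  map_add' x y := D.commForm_add_left x y z

/-- The commutator pairing in the second variable, as an additive homomorphism. [cite: Brown1982, Ch. IV §3 (extensions defined by a 2-cocycle)] -/
def commFormRightHom (x : M) : M →+ A where
  toFun z := D.commForm x z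
  map_zero' := D.commForm_zero_right x
  map_add' y z := D.commForm_add_right x y z

/-- `e(n • x, y) = n • e(x, y)`. [cite: Brown1982, Ch. IV §3 (extensions defined by a 2-cocycle)] -/
theorem commForm_zsmul_left (n : ℤ) (x y : M) : D.commForm (n • x) y = n • D.commForm x y :=
  map_zsmul (D.commFormLeftHom y) n x

/-- `e(x, n • y) = n • e(x, y)`. [cite: Brown1982, Ch. IV §3 (extensions defined by a 2-cocycle)] -/
theorem commForm_zsmul_right (n : ℤ) (x y : M) : D.commForm x (n • y) = n • D.commForm x y :=
  map_zsmul (D.commFormRightHom x) n y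

/-- **Equivariance of the commutator pairing**: `σ e(x, y) = e(σx, σy)` (from `smul_m`: `σ` acts on the
extension by group automorphisms). [cite: Brown1982, Ch. IV §3 (extensions defined by a 2-cocycle)] -/
theorem α_commForm (g : G) (x y : M) : D.α g (D.commForm x y) = D.commForm (D.ρ g x) (D.ρ g y) := by
  simp only [commForm_apply, map_sub]
  have s1 := D.smul_m g x y
  have s2 := D.smul_m g y x
  rw [add_comm y x] at s2
  linear_combination (norm := abel) s1 - s2

/-- The commutator pairing as a `ℤ`-bilinear map. [cite: Brown1982, Ch. IV §3 (extensions defined by a 2-cocycle)] -/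
def commFormBilin : M →ₗ[ℤ] M →ₗ[ℤ] A :=
  LinearMap.mk₂ ℤ D.commForm D.commForm_add_left D.commForm_zsmul_left D.commForm_add_right D.commForm_zsmul_right

/-- Unfolding `commFormBilin`. [cite: Brown1982, Ch. IV §3 (extensions defined by a 2-cocycle)] -/
@[simp] theorem commFormBilin_apply (x y : M) : D.commFormBilin x y = D.commForm x y := rfl

end HeisenbergDatum

end Literature.Algebra.Homology

noncomputable section

open scoped Classical

namespace Literature.NumberTheory.EllipticCurves

namespace ThetaLevelTwo

open Literature.Algebra.Homology
open Literature.NumberTheory.GaloisRepresentations Literature.NumberTheory.GaloisRepresentations.DiscreteGaloisModule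
open WeierstrassCurve Field

universe u

variable {K : Type u} [Field K] (W : WeierstrassCurve K) [W.IsElliptic] (h2 : (2 : K) ≠ 0)
variable (L : Type u) [Field L] [Algebra K L]

/-! ### The Weil pairing `e₂` as a continuous equivariant pairing `E[2] × E[2] → μ₂` over `Γ_L` -/

/-- **The level-`2` Weil pairing as a pairing of topological Galois representations over `Γ_L`**: the
commutator pairing of the Heisenberg (theta) group of `E[2]`, `e₂(P, Q) ∈ μ₂(K̄)` (`= −1` iff `P ≠ Q` are
both nonzero, `coe_toMul_commForm_heisenbergGm`). [cite: PoonenRains2012, §4.1 (the commutator pairing of the Heisenberg group is the Weil pairing e_λ)] -/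
def weilPairingTwo :
    ContPairing (DiscreteGaloisModule.toTopRep (GaloisRep.restrictField L (W.torsionGaloisModule 2)))
      (DiscreteGaloisModule.toTopRep (GaloisRep.restrictField L (W.torsionGaloisModule 2)))
      (DiscreteGaloisModule.toTopRep (GaloisRep.restrictField L (mu K 2))) :=
  ContPairing.ofDiscrete (localDatum W h2 L).commFormBilin fun σ P Q => by
    rw [toTopRep_torsion_ρ_apply, toTopRep_torsion_ρ_apply, toTopRep_mu_ρ_apply, HeisenbergDatum.commFormBilin_apply,
      HeisenbergDatum.commFormBilin_apply, ← localDatum_ρ_apply W h2 L, ← localDatum_ρ_apply W h2 L,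
      ← localDatum_α_apply W h2 L, HeisenbergDatum.α_commForm]

/-- Values of `weilPairingTwo`. [cite: PoonenRains2012, §4.1 (the commutator pairing of the Heisenberg group is the Weil pairing e_λ)] -/
@[simp] theorem weilPairingTwo_toLin (P Q : geomTorsion W 2) :
    (weilPairingTwo W h2 L).toLin P Q = (localDatum W h2 L).commForm P Q := rfl

/-- `e₂` is alternating: `e₂(P, P) = 0`. [cite: PoonenRains2012, §4.1 (e_λ is alternating)] -/
@[simp] theorem weilPairingTwo_self (P : geomTorsion W 2) : (weilPairingTwo W h2 L).toLin P P = 0 :=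
  (localDatum W h2 L).commForm_self P

/-! ### The polar identity on cocycles -/

omit [W.IsElliptic] in
/-- `cocycleFun (ξ + η) = cocycleFun ξ + cocycleFun η`. [cite: SerreGaloisCohomology1997, I §2.2 (cochains)] -/
theorem cocycleFun_add
    (ξ η : contOneCocycles (DiscreteGaloisModule.toTopRep (GaloisRep.restrictField L (W.torsionGaloisModule 2)))) :
    cocycleFun W L (ξ + η) = cocycleFun W L ξ + cocycleFun W L η := rfl

/-- The correcting `1`-cochain `b(σ) = −m(ξ_σ, η_σ)` of the polar identity (a function into `μ₂(K̄)`).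
[cite: PoonenRains2012, Cor. 4.6 (the connecting map is quadratic with polar form the cup product)] -/
def polarFun
    (ξ η : contOneCocycles (DiscreteGaloisModule.toTopRep (GaloisRep.restrictField L (W.torsionGaloisModule 2)))) :
    absoluteGaloisGroup L → MuCarrier K 2 :=
  fun σ => -(heisenbergMu W h2).m (cocycleFun W L ξ σ) (cocycleFun W L η σ)

/-- Values of `polarFun`. [cite: PoonenRains2012, Cor. 4.6 (the connecting map is quadratic with polar form the cup product)] -/
@[simp] theorem polarFun_apply
    (ξ η : contOneCocycles (DiscreteGaloisModule.toTopRep (GaloisRep.restrictField L (W.torsionGaloisModule 2))))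
    (σ : absoluteGaloisGroup L) :
    polarFun W h2 L ξ η σ = -(localDatum W h2 L).m (ξ.1 σ) (η.1 σ) := rfl

/-- `polarFun` is continuous (it factors through the discrete `E[2] × E[2]`).
[cite: SerreGaloisCohomology1997, I §2.2 (continuous cochains)] -/
theorem continuous_polarFun
    (ξ η : contOneCocycles (DiscreteGaloisModule.toTopRep (GaloisRep.restrictField L (W.torsionGaloisModule 2)))) :
    Continuous (polarFun W h2 L ξ η) := by
  have heq : polarFun W h2 L ξ η = (fun p : geomTorsion W 2 × geomTorsion W 2 => -(heisenbergMu W h2).m p.1 p.2)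
      ∘ fun σ => (cocycleFun W L ξ σ, cocycleFun W L η σ) := rfl
  rw [heq]
  exact continuous_of_discreteTopology.comp ((continuous_cocycleFun W L ξ).prodMk (continuous_cocycleFun W L η))

/-- The correcting continuous `1`-cochain `b = −m(ξ, η)` with values in `μ₂|_{Γ_L}`.
[cite: PoonenRains2012, Cor. 4.6 (the connecting map is quadratic with polar form the cup product)] -/
def polarCochain
    (ξ η : contOneCocycles (DiscreteGaloisModule.toTopRep (GaloisRep.restrictField L (W.torsionGaloisModule 2)))) :
    C(absoluteGaloisGroup L, DiscreteGaloisModule.toTopRep (GaloisRep.restrictField L (mu K 2))) :=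
  ⟨polarFun W h2 L ξ η, continuous_polarFun W h2 L ξ η⟩

/-- Values of `polarCochain`. [cite: PoonenRains2012, Cor. 4.6 (the connecting map is quadratic with polar form the cup product)] -/
@[simp] theorem polarCochain_apply
    (ξ η : contOneCocycles (DiscreteGaloisModule.toTopRep (GaloisRep.restrictField L (W.torsionGaloisModule 2))))
    (σ : absoluteGaloisGroup L) :
    polarCochain W h2 L ξ η σ = -(localDatum W h2 L).m (ξ.1 σ) (η.1 σ) := rfl

/-- **The polar identity on cocycles**: `prCocycle (ξ+η) (σ,τ) = prCocycle ξ (σ,τ) + prCocycle η (σ,τ)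
+ (η ∪_{e₂} ξ)(σ,τ) + (σ b(τ) − b(στ) + b(σ))`, `b(σ) = −m(ξ_σ, η_σ)` (`HeisenbergDatum.conn_add`).
[cite: PoonenRains2012, Cor. 4.6 (the connecting map is quadratic with polar form the cup product)] -/
theorem prCocycle_add_apply
    (ξ η : contOneCocycles (DiscreteGaloisModule.toTopRep (GaloisRep.restrictField L (W.torsionGaloisModule 2))))
    (σ τ : absoluteGaloisGroup L) :
    (prCocycle W h2 L (ξ + η)).1 (σ, τ)
      = (prCocycle W h2 L ξ).1 (σ, τ) + (prCocycle W h2 L η).1 (σ, τ)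
        + ((weilPairingTwo W h2 L).cupCocycle η ξ).1 (σ, τ)
        + ((DiscreteGaloisModule.toTopRep (GaloisRep.restrictField L (mu K 2))).ρ σ (polarCochain W h2 L ξ η τ)
            - polarCochain W h2 L ξ η (σ * τ) + polarCochain W h2 L ξ η σ) := by
  rw [prCocycle_apply, prCocycle_apply, prCocycle_apply, ContPairing.cupCocycle_apply_eq_smul, cocycleFun_add,
    (localDatum W h2 L).conn_add (isCrossedHom_of_mem W h2 L ξ) (isCrossedHom_of_mem W h2 L η) σ τ,
    weilPairingTwo_toLin, polarCochain_apply, polarCochain_apply, polarCochain_apply, toTopRep_mu_ρ_apply,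
    toTopRep_torsion_ρ_apply, ← localDatum_α_apply W h2 L, ← localDatum_ρ_apply W h2 L, map_neg,
    cocycleFun_apply, cocycleFun_apply, cocycleFun_apply, cocycleFun_apply, cocycleFun_apply, cocycleFun_apply]
  abel

/-- The polar identity as "the difference is the coboundary of `b`".
[cite: PoonenRains2012, Cor. 4.6 (the connecting map is quadratic with polar form the cup product)] -/
theorem prCocycle_add_sub_eq
    (ξ η : contOneCocycles (DiscreteGaloisModule.toTopRep (GaloisRep.restrictField L (W.torsionGaloisModule 2))))
    (σ τ : absoluteGaloisGroup L) :
    (prCocycle W h2 L (ξ + η) - (prCocycle W h2 L ξ + prCocycle W h2 L η + (weilPairingTwo W h2 L).cupCocycle η ξ)).1 (σ, τ)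
      = (DiscreteGaloisModule.toTopRep (GaloisRep.restrictField L (mu K 2))).ρ σ (polarCochain W h2 L ξ η τ)
          - polarCochain W h2 L ξ η (σ * τ) + polarCochain W h2 L ξ η σ := by
  rw [Submodule.coe_sub, Submodule.coe_add, Submodule.coe_add, ContinuousMap.sub_apply, ContinuousMap.add_apply,
    ContinuousMap.add_apply, prCocycle_add_apply]
  abel

/-! ### The polar identity on classes -/

variable [CharZero L]

/-- The cup product `a ∪_{e₂} b ∈ H²(Γ_L, μ₂)` of two classes of `H¹(Γ_L, E[2])` for the Weil pairing.
[cite: PoonenRains2012, §4.1 (the pairing ∪_{e_λ} on H¹(k, A[λ]))] -/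
def weilCup (a b : galoisCohomology (GaloisRep.restrictField L (W.torsionGaloisModule 2)) 1) :
    galoisCohomology (GaloisRep.restrictField L (mu K 2)) 2 :=
  (weilPairingTwo W h2 L).cupProduct a b

/-- `weilCup` on representatives: the class of `(σ,τ) ↦ e₂(ξ_σ, σ η_τ)`.
[cite: PoonenRains2012, §4.1 (the pairing ∪_{e_λ} on H¹(k, A[λ]))] -/
theorem weilCup_oneCocycleClass
    (ξ η : contOneCocycles (DiscreteGaloisModule.toTopRep (GaloisRep.restrictField L (W.torsionGaloisModule 2)))) :
    weilCup W h2 L (oneCocycleClass _ ξ) (oneCocycleClass _ η) = twoCocycleClass _ ((weilPairingTwo W h2 L).cupCocycle ξ η) :=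
  ContPairing.cupProduct_oneCocycleClass_eq_twoCocycleClass _ ξ η

/-- `weilCup` is additive in the first variable. [cite: PoonenRains2012, §4.1 (∪_{e_λ} is bilinear)] -/
theorem weilCup_add_left (a a' b : galoisCohomology (GaloisRep.restrictField L (W.torsionGaloisModule 2)) 1) :
    weilCup W h2 L (a + a') b = weilCup W h2 L a b + weilCup W h2 L a' b := by
  exact DFunLike.congr_fun (map_add (weilPairingTwo W h2 L).cupProduct a a') b

/-- `weilCup` is additive in the second variable. [cite: PoonenRains2012, §4.1 (∪_{e_λ} is bilinear)] -/
theorem weilCup_add_right (a b b' : galoisCohomology (GaloisRep.restrictField L (W.torsionGaloisModule 2)) 1) :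
    weilCup W h2 L a (b + b') = weilCup W h2 L a b + weilCup W h2 L a b' :=
  map_add ((weilPairingTwo W h2 L).cupProduct a) b b'

/-- **The Poonen–Rains map is quadratic with polar form the Weil-pairing cup product** (Poonen–Rains 2012
Cor. 4.6 / Prop. 4.7; Zarhin): for `a, b ∈ H¹(Γ_L, E[2])`,
`q_L(a + b) = q_L(a) + q_L(b) + (b ∪_{e₂} a)` in `H²(Γ_L, μ₂)`.
[cite: PoonenRains2012, Cor. 4.6 (q is a quadratic form whose associated bilinear pairing is ∪_{e_λ})] -/
theorem prClass_add (a b : galoisCohomology (GaloisRep.restrictField L (W.torsionGaloisModule 2)) 1) :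
    prClass W h2 L (a + b) = prClass W h2 L a + prClass W h2 L b + weilCup W h2 L b a := by
  obtain ⟨ξ, rfl⟩ := oneCocycleClass_surjective _ a
  obtain ⟨η, rfl⟩ := oneCocycleClass_surjective _ b
  have key : twoCocycleClass _ (prCocycle W h2 L (ξ + η)
      - (prCocycle W h2 L ξ + prCocycle W h2 L η + (weilPairingTwo W h2 L).cupCocycle η ξ)) = 0 :=
    (twoCocycleClass_eq_zero_iff _ _).mpr ⟨polarCochain W h2 L ξ η, prCocycle_add_sub_eq W h2 L ξ η⟩
  rw [twoCocycleClass_sub, twoCocycleClass_add, twoCocycleClass_add, sub_eq_zero] at key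
  calc prClass W h2 L (oneCocycleClass _ ξ + oneCocycleClass _ η)
      = prClass W h2 L (oneCocycleClass _ (ξ + η)) := congrArg (prClass W h2 L) (oneCocycleClass_add _ ξ η).symm
    _ = twoCocycleClass _ (prCocycle W h2 L (ξ + η)) := prClass_oneCocycleClass W h2 L _
    _ = twoCocycleClass _ (prCocycle W h2 L ξ) + twoCocycleClass _ (prCocycle W h2 L η)
          + twoCocycleClass _ ((weilPairingTwo W h2 L).cupCocycle η ξ) := key
    _ = _ := by rw [prClass_oneCocycleClass, prClass_oneCocycleClass, weilCup_oneCocycleClass]; rfl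

/-- The symmetric form of the polar identity: `q_L(a + b) − q_L(a) − q_L(b) = b ∪_{e₂} a`.
[cite: PoonenRains2012, Cor. 4.6 (q is a quadratic form whose associated bilinear pairing is ∪_{e_λ})] -/
theorem prClass_add_sub_sub (a b : galoisCohomology (GaloisRep.restrictField L (W.torsionGaloisModule 2)) 1) :
    prClass W h2 L (a + b) - prClass W h2 L a - prClass W h2 L b = weilCup W h2 L b a := by
  rw [prClass_add W h2 L a b]
  abel

/-- **The cup product of the Weil pairing is symmetric on classes** (it is the polar form of `q_L`):
`a ∪_{e₂} b = b ∪_{e₂} a` in `H²(Γ_L, μ₂)`. [cite: PoonenRains2012, Cor. 4.6 (the associated bilinear pairing of q is symmetric)] -/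
theorem weilCup_comm (a b : galoisCohomology (GaloisRep.restrictField L (W.torsionGaloisModule 2)) 1) :
    weilCup W h2 L a b = weilCup W h2 L b a := by
  rw [← prClass_add_sub_sub W h2 L b a, ← prClass_add_sub_sub W h2 L a b, add_comm b a]
  abel

end ThetaLevelTwo

end Literature.NumberTheory.EllipticCurves
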